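import Literature.Probability.Percolation.ArmEvents
import Literature.Probability.Percolation.SharpnessDCTProofs
import Literature.Probability.Percolation.InequalitiesProofs
import Literature.Probability.Percolation.FiniteEnergy
import Literature.Probability.Percolation.RSW
import Literature.Probability.Percolation.PlanarDuality
import HarnessLib

/-!
# Decoupling on the cluster of the origin: tools for the INFLUENCE CRITERION (lane RSW3, ladder R3.6′; seat p1) — part 1/2

builds on p205010 (kernel theorem, internal audit signed; external expert review pending)

Cell `prim-rsw3` (post-continuity programme, LANE 3), seat `prim-rsw3-p1`.  Memo
`run/shared/lean/prim/rsw3/P1-QM.md` §2.5.  Support file (helper); no definitions, no sorries; does not use p205010.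

Notation (prose; everything is written inline below).  Scales `n ≤ N`, inner radius `r`; `Λ(k) = box d k`;
`A = {0 ↔ ∂ⁱⁿΛ(n) in Λ(n)}` (`siteToBoundary d n`, probability `π_p(n) = oneArmProb d p n`), `C = {0 ↔ ∂ⁱⁿΛ(N)}`;
`Ann = {Λ(r) ↔ ∂ⁱⁿΛ(N) in Λ(N)}` (probability `α`), and for a vertex set `K ⊆ Λ(N)`,
`Ann∖K = {Λ(r) ↔ ∂ⁱⁿΛ(N) in Λ(N) ∖ K}` (probability `α(Λ(N)∖K) ≤ α`); `𝒞 = C(0; Λ(N))` the cluster of the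
origin computed inside `Λ(N)` (the tree's `DCT16.clusterSet` / `DCT16.clusterEvent`); `𝒦` = the vertex sets
`K ⊆ Λ(N)` meeting `∂ⁱⁿΛ(n)` and missing `∂ⁱⁿΛ(N)` (the possible values of `𝒞` on `A ∖ C`).

* `openConnIn_sdiff_of_clusterEvent` — AVOIDANCE: on `{𝒞 = K}`, an open path inside `Λ(N)` ending outside
  `K` never touches `K`, so it is an open path inside `Λ(N) ∖ K`;
* `real_clusterEvent_inter_cross_eq` — DECOUPLING: for `K ∈ 𝒦`,
  `P({𝒞 = K} ∩ Ann) = P({𝒞 = K}) · α(Λ(N)∖K)` (avoidance + the two events read the disjoint pair-sets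
  `clusterPairs Λ(N) K` / `(Λ(N)∖K).sym2`; Duminil-Copin–Tassion's exploration step);
(part 2/2, `PercNearOneGluingNoHeavyOneArmInfluence.lean`, proves from these:)
* `influence_sum_le` — **the influence bound**:
  `Σ_{K∈𝒦} P(𝒞 = K)·(α − α(Λ(N)∖K)) ≤ (1 − α)·π_p(N)`, i.e. (dividing by `P(A∖C) = π(n) − π(N)`)
  `J·(π(n) − π(N)) ≤ (1 − α) π(N)` with `J = E[α − α(Λ(N)∖𝒞) | A ∖ C]` the mean drop of the crossing
  probability caused by deleting the arm cluster.  Proof: Harris (`π(n)·α ≤ P(A ∩ Ann)`) + the decomposition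
  `P(A ∩ Ann) ≤ π(N) + Σ_{K∈𝒦} P(𝒞 = K)·α(Λ(N)∖K)` + `Σ_{K∈𝒦} P(𝒞 = K) = π(n) − π(N)`.
* `oneArmProb_doubling_of_influence` — **INFLUENCE CRITERION**: if `Σ_{K∈𝒦} P(𝒞=K)(α − α(Λ(N)∖K)) ≥ c·(π(n) − π(N))`
  (i.e. `J ≥ c`) then `c·π_p(n) ≤ (1 − α + c)·π_p(N)`, in particular `π_p(N) ≥ (c/(1+c))·π_p(n)` — an
  (S2)-sufficient condition with NO blocking hypothesis (contrast the covariance criterion of ladder R3.6,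
  whose hypothesis `Cov ≥ η π(n)` forces `1 − α ≥ η`, a hyperscaling-side statement false above six dimensions:
  `cov_le`, `Cov(1_A, 1_Ann) ≤ (1 − α)·π(N)`).
* `sum_real_clusterEvent_arm`, `real_arm_inter_cross_le` — the two bookkeeping identities behind it.

Honest scope: these are identities/inequalities valid at every `p` and `d`; the hypothesis `J ≥ c` at `p_c(ℤ³)`
("a fresh critical annulus crossing meets the arm cluster with probability ≥ c") is OPEN — a two-independent-clusters
intersection estimate, heuristically true for `d < 6` (`2 d_f > d`) and false for `d > 6`.

References: H. Duminil-Copin, V. Tassion, Enseign. Math. 62 (2016), §2.1 (exploration of the cluster of the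
origin; the tree's `DCT16.clusterEvent`, `determinedBy_clusterEvent`); G. Grimmett, *Percolation* (1999), Thm. (2.4)
(Harris–FKG) and §2.2.
-/

noncomputable section

namespace Summit.CriticalPhenomena.PercolationContinuityZ3.Theorems.RSW3

open MeasureTheory Literature.Probability.Percolation Literature.Probability.LatticeModels
open Literature.Probability.Percolation.DCT16

variable {d : ℕ}

/-! ## Avoidance and decoupling on `{𝒞 = K}` -/

/-- **Avoidance.**  If `C(0; S) = K` and `y ∉ K`, every open path inside `S` from `x` to `y` avoids `K`
(a vertex of the path in `K` would put `y` in the cluster of `0`), so `{x ↔ y in S} ⊆ {x ↔ y in S ∖ K}` on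
`{𝒞 = K}`. [cite: DuminilCopinTassionEM2016, §2.1] -/
theorem openConnIn_sdiff_of_clusterEvent {S K : Finset (Site d)} {ω : BondConfig (Site d)}
    (hK : ω ∈ clusterEvent S K) {x y : Site d} (hy : y ∉ K)
    (hxy : ω ∈ openConnIn (↑S : Set (Site d)) x y) :
    ω ∈ openConnIn ((↑S : Set (Site d)) \ ↑K) x y := by
  have hK' : clusterSet S ω = ↑K := hK
  -- walk back from `y`
  have hp : PathIn (openGraph ω) (↑S : Set (Site d)) y x := by
    rw [openConnIn_comm] at hxy
    exact pathIn_of_mem_openConnIn hxy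
  have key : x ∉ K ∧ PathIn (openGraph ω) ((↑S : Set (Site d)) \ ↑K) y x := by
    refine pathIn_induction (fun v => v ∉ K ∧ PathIn (openGraph ω) ((↑S : Set (Site d)) \ ↑K) y v) hp
      ⟨hy, PathIn.refl ⟨hp.left_mem, fun h => hy (Finset.mem_coe.1 h)⟩⟩ ?_
    intro a b ha hb hPa hab
    have hbK : b ∉ K := by
      intro hbK
      have hb' : b ∈ clusterSet S ω := by rw [hK']; exact Finset.mem_coe.2 hbK
      have ha' : ω ∈ openConnIn (↑S : Set (Site d)) 0 a :=
        mem_openConnIn_of_pathIn ((pathIn_of_mem_openConnIn hb').tail hab.symm ha)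
      have : a ∈ (↑K : Set (Site d)) := by rw [← hK']; exact ha'
      exact hPa.1 (Finset.mem_coe.1 this)
    exact ⟨hbK, hPa.2.tail hab ⟨hb, fun h => hbK (Finset.mem_coe.1 h)⟩⟩
  have := mem_openConnIn_of_pathIn key.2
  rwa [openConnIn_comm] at this

/-- On `{𝒞 = K}` with `K` missing `∂ⁱⁿΛ(N)`, the crossing `Λ(r) ↔ ∂ⁱⁿΛ(N)` happens inside `Λ(N)` iff it happens
inside `Λ(N) ∖ K`. [cite: DuminilCopinTassionEM2016, §2.1] -/
theorem clusterEvent_inter_cross_eq {N r : ℕ} {K : Finset (Site d)}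
    (hKN : ∀ z ∈ K, z ∉ innerBoundary (zdGraph d) (box d N)) :
    clusterEvent (box d N) K ∩
        {ω | ∃ x ∈ box d r, ∃ y ∈ innerBoundary (zdGraph d) (box d N),
          ω ∈ openConnIn (↑(box d N) : Set (Site d)) x y} =
      clusterEvent (box d N) K ∩
        {ω | ∃ x ∈ box d r, ∃ y ∈ innerBoundary (zdGraph d) (box d N),
          ω ∈ openConnIn ((↑(box d N) : Set (Site d)) \ ↑K) x y} := by
  ext ω
  constructor
  · rintro ⟨hK, x, hx, y, hy, hxy⟩
    exact ⟨hK, x, hx, y, hy, openConnIn_sdiff_of_clusterEvent hK (fun h => hKN y h hy) hxy⟩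
  · rintro ⟨hK, x, hx, y, hy, hxy⟩
    exact ⟨hK, x, hx, y, hy, openConnIn_mono Set.sdiff_subset _ _ hxy⟩

/-- The crossing event inside `Λ(N) ∖ K` reads only the pairs inside `Λ(N) ∖ K`. [folklore] -/
theorem determinedBy_cross_sdiff (N r : ℕ) (K : Finset (Site d)) :
    DeterminedBy {ω : BondConfig (Site d) | ∃ x ∈ box d r, ∃ y ∈ innerBoundary (zdGraph d) (box d N),
        ω ∈ openConnIn ((↑(box d N) : Set (Site d)) \ ↑K) x y}
      (↑((box d N \ K).sym2) : Set (Sym2 (Site d))) := by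
  have h : {ω : BondConfig (Site d) | ∃ x ∈ box d r, ∃ y ∈ innerBoundary (zdGraph d) (box d N),
      ω ∈ openConnIn ((↑(box d N) : Set (Site d)) \ ↑K) x y} =
      ⋃ x ∈ box d r, ⋃ y ∈ innerBoundary (zdGraph d) (box d N),
        openConnIn ((↑(box d N) : Set (Site d)) \ ↑K) x y := by
    ext ω; simp only [Set.mem_setOf_eq, Set.mem_iUnion, exists_prop]
  rw [h]
  refine DeterminedBy.iUnion fun x => DeterminedBy.iUnion fun _ =>
    DeterminedBy.iUnion fun y => DeterminedBy.iUnion fun _ => determinedBy_openConnIn _ x y ?_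
  rw [Finset.coe_sym2, Finset.coe_sdiff]

/-- The crossing event inside `Λ(N) ∖ K` is measurable. [folklore] -/
theorem measurableSet_cross_sdiff (N r : ℕ) (K : Finset (Site d)) :
    MeasurableSet {ω : BondConfig (Site d) | ∃ x ∈ box d r, ∃ y ∈ innerBoundary (zdGraph d) (box d N),
        ω ∈ openConnIn ((↑(box d N) : Set (Site d)) \ ↑K) x y} := by
  have h : {ω : BondConfig (Site d) | ∃ x ∈ box d r, ∃ y ∈ innerBoundary (zdGraph d) (box d N),
      ω ∈ openConnIn ((↑(box d N) : Set (Site d)) \ ↑K) x y} =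
      ⋃ x ∈ box d r, ⋃ y ∈ innerBoundary (zdGraph d) (box d N),
        openConnIn ((↑(box d N) : Set (Site d)) \ ↑K) x y := by
    ext ω; simp only [Set.mem_setOf_eq, Set.mem_iUnion, exists_prop]
  rw [h]
  refine Finset.measurableSet_biUnion _ fun x _ => Finset.measurableSet_biUnion _ fun y _ => ?_
  rw [← Finset.coe_sdiff]
  exact measurableSet_openConnIn _ x y

/-- The crossing event inside `Λ(N)` is measurable. [folklore] -/
theorem measurableSet_cross (N r : ℕ) :
    MeasurableSet {ω : BondConfig (Site d) | ∃ x ∈ box d r, ∃ y ∈ innerBoundary (zdGraph d) (box d N),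
        ω ∈ openConnIn (↑(box d N) : Set (Site d)) x y} := by
  have h : {ω : BondConfig (Site d) | ∃ x ∈ box d r, ∃ y ∈ innerBoundary (zdGraph d) (box d N),
      ω ∈ openConnIn (↑(box d N) : Set (Site d)) x y} =
      ⋃ x ∈ box d r, ⋃ y ∈ innerBoundary (zdGraph d) (box d N), openConnIn (↑(box d N) : Set (Site d)) x y := by
    ext ω; simp only [Set.mem_setOf_eq, Set.mem_iUnion, exists_prop]
  rw [h]
  exact Finset.measurableSet_biUnion _ fun x _ => Finset.measurableSet_biUnion _ fun y _ =>
    measurableSet_openConnIn _ x y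

/-- The crossing event inside `Λ(N)` is increasing. [folklore] -/
theorem isUpperSet_cross (N r : ℕ) :
    IsUpperSet {ω : BondConfig (Site d) | ∃ x ∈ box d r, ∃ y ∈ innerBoundary (zdGraph d) (box d N),
        ω ∈ openConnIn (↑(box d N) : Set (Site d)) x y} := by
  rintro ω ω' hle ⟨x, hx, y, hy, h⟩
  exact ⟨x, hx, y, hy, isUpperSet_openConnIn _ x y hle h⟩

/-- **Decoupling** (Duminil-Copin–Tassion's exploration step): for `K ⊆ Λ(N)` missing `∂ⁱⁿΛ(N)`,
`P({𝒞 = K} ∩ {Λ(r) ↔ ∂ⁱⁿΛ(N) in Λ(N)}) = P({𝒞 = K}) · P(Λ(r) ↔ ∂ⁱⁿΛ(N) in Λ(N) ∖ K)`: avoidance, and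
`{𝒞 = K}` reads the pairs of `Λ(N)` touching `K` while the crossing off `K` reads the pairs inside `Λ(N) ∖ K`.
[cite: DuminilCopinTassionEM2016, §2.1] -/
theorem real_clusterEvent_inter_cross_eq (p : unitInterval) {N r : ℕ} {K : Finset (Site d)}
    (hKN : ∀ z ∈ K, z ∉ innerBoundary (zdGraph d) (box d N)) :
    (bondPercolation (zdGraph d) p).real (clusterEvent (box d N) K ∩
        {ω | ∃ x ∈ box d r, ∃ y ∈ innerBoundary (zdGraph d) (box d N),
          ω ∈ openConnIn (↑(box d N) : Set (Site d)) x y}) =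
      (bondPercolation (zdGraph d) p).real (clusterEvent (box d N) K) *
        (bondPercolation (zdGraph d) p).real
          {ω | ∃ x ∈ box d r, ∃ y ∈ innerBoundary (zdGraph d) (box d N),
            ω ∈ openConnIn ((↑(box d N) : Set (Site d)) \ ↑K) x y} := by
  rw [clusterEvent_inter_cross_eq hKN]
  refine bondPercolation_real_inter_of_disjoint (zdGraph d) p ?_ (determinedBy_clusterEvent (zero_mem_box d N))
    (determinedBy_cross_sdiff N r K) (measurableSet_clusterEvent (zero_mem_box d N)) (measurableSet_cross_sdiff N r K)
  rw [clusterPairs]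
  exact Finset.disjoint_coe.2 Finset.sdiff_disjoint

/-! ## The cluster of the origin decides the arm events -/

/-- Pointwise monotonicity of the one-arm event on lattice configurations: `{0 ↔ ∂ⁱⁿΛ(N)} ⊆ {0 ↔ ∂ⁱⁿΛ(n)}`
for `n ≤ N`. [folklore] -/
theorem mem_siteToBoundary_of_le {n N : ℕ} (hnN : n ≤ N) {ω : BondConfig (Site d)}
    (hω : ω ⊆ (zdGraph d).edgeSet) (h : ω ∈ siteToBoundary d N) : ω ∈ siteToBoundary d n := by
  rcases hnN.eq_or_lt with rfl | hlt
  · exact h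
  obtain ⟨y, hy, hpath⟩ := h
  rw [← armEvent_zero]
  exact armEvent_of_pathIn hω (pathIn_of_mem_openConnIn hpath)
    (Or.inl (by rw [sub_zero]; exact notMem_box_of_mem_innerBoundary_box hlt hy))

/-- On `{𝒞 = K}` (cluster inside `Λ(N)`, `n ≤ N`, lattice configuration): `0 ↔ ∂ⁱⁿΛ(n)` iff `K` meets
`∂ⁱⁿΛ(n)`. [cite: DuminilCopinTassionEM2016, §2.1] -/
theorem mem_siteToBoundary_iff_of_clusterEvent {n N : ℕ} (hnN : n ≤ N) {K : Finset (Site d)}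
    {ω : BondConfig (Site d)} (hω : ω ⊆ (zdGraph d).edgeSet) (hK : ω ∈ clusterEvent (box d N) K) :
    ω ∈ siteToBoundary d n ↔ ∃ z ∈ K, z ∈ innerBoundary (zdGraph d) (box d n) := by
  have hK' : clusterSet (box d N) ω = ↑K := hK
  constructor
  · rintro ⟨z, hz, hpath⟩
    refine ⟨z, ?_, hz⟩
    have : z ∈ clusterSet (box d N) ω :=
      openConnIn_mono (Finset.coe_subset.2 (box_mono d hnN)) _ _ hpath
    rw [hK'] at this
    exact Finset.mem_coe.1 this
  · rintro ⟨z, hzK, hz⟩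
    have hz' : z ∈ clusterSet (box d N) ω := by rw [hK']; exact Finset.mem_coe.2 hzK
    rw [← armEvent_zero]
    exact armEvent_of_pathIn hω (pathIn_of_mem_openConnIn hz') (Or.inr (by rw [sub_zero]; exact hz))

/-- On `{𝒞 = K}` (cluster inside `Λ(N)`): `0 ↔ ∂ⁱⁿΛ(N)` iff `K` meets `∂ⁱⁿΛ(N)`. [cite: DuminilCopinTassionEM2016, §2.1] -/
theorem mem_siteToBoundary_iff_of_clusterEvent_self {N : ℕ} {K : Finset (Site d)}
    {ω : BondConfig (Site d)} (hK : ω ∈ clusterEvent (box d N) K) :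
    ω ∈ siteToBoundary d N ↔ ∃ z ∈ K, z ∈ innerBoundary (zdGraph d) (box d N) := by
  have hK' : clusterSet (box d N) ω = ↑K := hK
  constructor
  · rintro ⟨z, hz, hpath⟩
    have : z ∈ clusterSet (box d N) ω := hpath
    rw [hK'] at this
    exact ⟨z, Finset.mem_coe.1 this, hz⟩
  · rintro ⟨z, hzK, hz⟩
    have hz' : z ∈ clusterSet (box d N) ω := by rw [hK']; exact Finset.mem_coe.2 hzK
    exact ⟨z, hz, hz'⟩

/-- **Partition of `A ∖ C` by the value of the cluster.**  For a lattice configuration and `n ≤ N`: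
`0 ↔ ∂ⁱⁿΛ(n)` and `0 ↮ ∂ⁱⁿΛ(N)` iff `𝒞 = K` for some `K ⊆ Λ(N)` meeting `∂ⁱⁿΛ(n)` and missing `∂ⁱⁿΛ(N)`.
[cite: DuminilCopinTassionEM2016, §2.1] -/
theorem mem_diff_iff_exists_clusterEvent {n N : ℕ} (hnN : n ≤ N) {ω : BondConfig (Site d)}
    (hω : ω ⊆ (zdGraph d).edgeSet) :
    ω ∈ siteToBoundary d n \ siteToBoundary d N ↔
      ∃ K ∈ (box d N).powerset.filter (fun K => (∃ z ∈ K, z ∈ innerBoundary (zdGraph d) (box d n)) ∧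
          ∀ z ∈ K, z ∉ innerBoundary (zdGraph d) (box d N)),
        ω ∈ clusterEvent (box d N) K := by
  classical
  constructor
  · rintro ⟨hA, hC⟩
    set K := (box d N).filter (· ∈ clusterSet (box d N) ω) with hKdef
    have hK : ω ∈ clusterEvent (box d N) K := (coe_filter_clusterSet (box d N) ω).symm
    refine ⟨K, Finset.mem_filter.2 ⟨Finset.mem_powerset.2 (Finset.filter_subset _ _), ?_, ?_⟩, hK⟩
    · exact (mem_siteToBoundary_iff_of_clusterEvent hnN hω hK).1 hA
    · intro z hz hzN
      exact hC ((mem_siteToBoundary_iff_of_clusterEvent_self hK).2 ⟨z, hz, hzN⟩)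
  · rintro ⟨K, hK𝒦, hK⟩
    obtain ⟨-, hKn, hKN⟩ := Finset.mem_filter.1 hK𝒦
    refine ⟨(mem_siteToBoundary_iff_of_clusterEvent hnN hω hK).2 hKn, fun hC => ?_⟩
    obtain ⟨z, hz, hzN⟩ := (mem_siteToBoundary_iff_of_clusterEvent_self hK).1 hC
    exact hKN z hz hzN

end Summit.CriticalPhenomena.PercolationContinuityZ3.Theorems.RSW3

end
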